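import Mathlib
import HarnessLib
import Literature.Analysis.FluidPDE.VectorCalculus
import Literature.Analysis.FluidPDE.TaoEnstrophyLocalisation
import Literature.Analysis.FluidPDE.VorticityCalculus
import Summits.NavierStokesRegularity.NavierStokesRegularity.Theorems.ThreadingFluxConeStructurePotential

/-!
# Route `ThreadingFlux`, support `ConeStructure` (stmt-NavierStokesRegularity-1221) — helper II:
# the radial part of the vorticity of a homogeneous field has zero mean on the unit ball

Part (i) of the support item `ConeStructure` (card T1 of route ThreadingFlux): for `U` smooth on
`ℝ³ ∖ {0}` and `(−1)`-homogeneous, `∫_{B₁} ⟨x, curl U(x)⟩/‖x‖ dx = 0` — «the flux of a curl through the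
unit sphere vanishes», done WITHOUT surface integrals:

* `integral_weight_mul_radialFlux_eq_zero` — for every smooth profile `η` vanishing near `s ≤ a` (`a > 0`)
  and for `s ≥ b`, `∫ η(‖x‖²) ⟨x, curl U(x)⟩/‖x‖ dx = 0` (no homogeneity needed): the radial test field
  `Ψ(x) = (η(‖x‖²)/‖x‖) x` is `C¹`, compactly supported and CURL-FREE (`curl_radial_eq_zero`), so the
  tree's curl-by-parts identity `VorticityCalculus.integral_inner_curl_eq_integral_inner_curl`, applied
  to `Ψ` and to `U` cut off smoothly near the origin, gives `∫ ⟨curl U, Ψ⟩ = ∫ ⟨U, curl Ψ⟩ = 0`;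
* `integral_radialFlux_ball_eq_zero` — with the plateaus `η_n(s) = S(ns − 1) S(n(1 − s))`
  (`S` = `Real.smoothTransition`) increasing to the indicator of `(0,1)`, the bound
  `‖curl U(x)‖ ≤ M‖x‖⁻²` of helper I (integrable on the ball of `ℝ³`, Mathlib's
  `integrableOn_ball_of_norm_le_rpow`) and dominated convergence.

No new definitions, no named facts; a vector-calculus lemma, nothing here bears on Navier–Stokes
regularity.

## References

* A. J. Majda, A. L. Bertozzi, *Vorticity and Incompressible Flow* (CUP 2002), §1.1 (vector
  identities), §2.3 (homogeneous kernels). [MajdaBertozziCUP2002]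
-/

noncomputable section

-- the summit and its single sub-problem share the name (CONVENTIONS §1), as in every Theorems file
set_option linter.dupNamespace false

namespace Summit.NavierStokesRegularity.NavierStokesRegularity.Theorems.ConeStructure

open Set Function Filter Topology Metric MeasureTheory
open scoped ContDiff RealInnerProductSpace
open Literature.Analysis.FluidPDE

variable {U : EuclideanSpace ℝ (Fin 3) → EuclideanSpace ℝ (Fin 3)}

/-! ### Radial test fields `Ψ(x) = p(‖x‖²) x` are curl-free -/

/-- Coordinates of the basis vectors. [folklore] -/
theorem single_apply_eq (i j : Fin 3) :
    (EuclideanSpace.single j (1:ℝ) : EuclideanSpace ℝ (Fin 3)) i = if i = j then 1 else 0 := by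
  rw [show (EuclideanSpace.single j (1:ℝ) : EuclideanSpace ℝ (Fin 3)) = PiLp.single 2 j 1 from rfl,
    PiLp.single_apply]

/-- **A radial field `x ↦ p(‖x‖²) x` (`p ∈ C¹`) is curl-free**: its Jacobian
`p(‖x‖²) 𝟙 + 2p′(‖x‖²) x ⊗ x` is symmetric. [cite: MajdaBertozziCUP2002, §1.1 (vector identities)] -/
theorem curl_radial_eq_zero {p : ℝ → ℝ} (hp : ContDiff ℝ 1 p) (x : EuclideanSpace ℝ (Fin 3)) :
    curl (fun y : EuclideanSpace ℝ (Fin 3) => p (‖y‖ ^ 2) • y) x = 0 := by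
  have h1 : HasFDerivAt (fun y : EuclideanSpace ℝ (Fin 3) => p (‖y‖ ^ 2))
      (deriv p (‖x‖ ^ 2) • (2 • innerSL ℝ x)) x := by
    have hp' : HasDerivAt p (deriv p (‖x‖ ^ 2)) (‖x‖ ^ 2) :=
      ((hp.differentiable one_ne_zero) _).hasDerivAt
    exact hp'.comp_hasFDerivAt x (hasStrictFDerivAt_norm_sq x).hasFDerivAt
  have hd : HasFDerivAt (fun y : EuclideanSpace ℝ (Fin 3) => p (‖y‖ ^ 2) • y)
      (p (‖x‖ ^ 2) • ContinuousLinearMap.id ℝ (EuclideanSpace ℝ (Fin 3)) +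
        (deriv p (‖x‖ ^ 2) • (2 • innerSL ℝ x)).smulRight x) x := h1.smul (hasFDerivAt_id x)
  have hij : ∀ i j : Fin 3, fderiv ℝ (fun y : EuclideanSpace ℝ (Fin 3) => p (‖y‖ ^ 2) • y) x
      (EuclideanSpace.single j 1) i =
      p (‖x‖ ^ 2) * (EuclideanSpace.single j (1:ℝ) : EuclideanSpace ℝ (Fin 3)) i +
        2 * deriv p (‖x‖ ^ 2) * x j * x i := by
    intro i j
    rw [hd.fderiv]
    simp only [add_apply, smul_apply, ContinuousLinearMap.id_apply,
      ContinuousLinearMap.smulRight_apply, innerSL_apply_apply,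
      EuclideanSpace.inner_single_right, PiLp.add_apply, PiLp.smul_apply, smul_eq_mul, nsmul_eq_mul,
      Nat.cast_ofNat, one_mul, conj_trivial]
    ring
  simp only [curl, hij, single_apply_eq]
  ext i
  fin_cases i <;> simp <;> ring

/-- A radial field with a `C¹` profile is `C¹`. [folklore] -/
theorem contDiff_radial {p : ℝ → ℝ} (hp : ContDiff ℝ 1 p) :
    ContDiff ℝ 1 (fun y : EuclideanSpace ℝ (Fin 3) => p (‖y‖ ^ 2) • y) :=
  (hp.comp (contDiff_norm_sq ℝ)).smul contDiff_id

/-- A radial field whose profile vanishes beyond `b` has compact support. [folklore] -/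
theorem hasCompactSupport_radial {p : ℝ → ℝ} {b : ℝ} (hpb : ∀ s, b ≤ s → p s = 0) :
    HasCompactSupport (fun y : EuclideanSpace ℝ (Fin 3) => p (‖y‖ ^ 2) • y) := by
  refine HasCompactSupport.intro (isCompact_closedBall (0 : EuclideanSpace ℝ (Fin 3)) (max b 1))
    fun y hy => ?_
  rw [mem_closedBall, dist_zero_right, not_le] at hy
  have h1 : 1 ≤ ‖y‖ := (le_max_right b 1).trans hy.le
  have hb : b ≤ ‖y‖ ^ 2 := by nlinarith [le_max_left b 1]
  simp [hpb _ hb]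

/-! ### The profile `η(s)/√s` -/

/-- If `η` is smooth and vanishes for `s ≤ a` (`a > 0`) then `s ↦ η(s)/√s` is smooth on `ℝ`
(it vanishes near every `s < a`, and `√·` is smooth on `(0, ∞)`). [folklore] -/
theorem contDiff_mul_inv_sqrt {η : ℝ → ℝ} (hη : ContDiff ℝ ∞ η) {a : ℝ} (ha : 0 < a)
    (hηa : ∀ s, s ≤ a → η s = 0) : ContDiff ℝ ∞ (fun s => η s * (Real.sqrt s)⁻¹) := by
  refine contDiff_iff_contDiffAt.2 fun s => ?_
  by_cases hs : a / 2 < s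
  · have hs0 : s ≠ 0 := by intro h; rw [h] at hs; linarith
    exact hη.contDiffAt.mul ((Real.contDiffAt_sqrt hs0).inv (Real.sqrt_ne_zero'.2 (by linarith)))
  · have hev : (fun s => η s * (Real.sqrt s)⁻¹) =ᶠ[𝓝 s] fun _ => 0 := by
      filter_upwards [Iio_mem_nhds (show s < a by linarith)] with t ht
      rw [hηa t (le_of_lt ht), zero_mul]
    exact (contDiffAt_const (c := (0:ℝ))).congr_of_eventuallyEq hev

/-! ### Cutting `U` off near the origin -/

/-- The cut-off `x ↦ S(4‖x‖²/a − 1) U(x)` of a field smooth off the origin is `C¹` on `ℝ³`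
(`S` = `Real.smoothTransition`; the factor vanishes for `‖x‖² ≤ a/4`). [folklore] -/
theorem contDiff_cutoff_smul (hU : ContDiffOn ℝ ∞ U {0}ᶜ) {a : ℝ} (ha : 0 < a) :
    ContDiff ℝ 1 (fun y : EuclideanSpace ℝ (Fin 3) =>
      Real.smoothTransition (4 * ‖y‖ ^ 2 / a - 1) • U y) := by
  have hθ : ContDiff ℝ 1 (fun y : EuclideanSpace ℝ (Fin 3) =>
      Real.smoothTransition (4 * ‖y‖ ^ 2 / a - 1)) :=
    Real.smoothTransition.contDiff.comp
      (((contDiff_const.mul (contDiff_norm_sq ℝ)).div_const a).sub contDiff_const)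
  refine contDiff_iff_contDiffAt.2 fun y => ?_
  by_cases hy : y = 0
  · subst hy
    have hev : (fun y : EuclideanSpace ℝ (Fin 3) => Real.smoothTransition (4 * ‖y‖ ^ 2 / a - 1) • U y)
        =ᶠ[𝓝 0] fun _ => 0 := by
      have ho : IsOpen {z : EuclideanSpace ℝ (Fin 3) | ‖z‖ ^ 2 < a / 4} :=
        isOpen_lt (continuous_norm.pow 2) continuous_const
      filter_upwards [ho.mem_nhds (by simp [ha])] with z hz
      have hz' : ‖z‖ ^ 2 < a / 4 := hz
      rw [Real.smoothTransition.zero_of_nonpos, zero_smul]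
      exact sub_nonpos.2 ((div_le_one ha).2 (by nlinarith))
    exact (contDiffAt_const (c := (0 : EuclideanSpace ℝ (Fin 3)))).congr_of_eventuallyEq hev
  · exact hθ.contDiffAt.smul ((hU.of_le (by norm_cast)).contDiffAt (isOpen_compl_singleton.mem_nhds hy))

/-- Away from the origin (`‖x‖² > a/2`) the cut-off field has the curl of `U`. [folklore] -/
theorem curl_cutoff_smul_eq {a : ℝ} (ha : 0 < a) {y : EuclideanSpace ℝ (Fin 3)}
    (hy : a / 2 < ‖y‖ ^ 2) :
    curl (fun z : EuclideanSpace ℝ (Fin 3) => Real.smoothTransition (4 * ‖z‖ ^ 2 / a - 1) • U z) y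
      = curl U y := by
  have hev : (fun z : EuclideanSpace ℝ (Fin 3) => Real.smoothTransition (4 * ‖z‖ ^ 2 / a - 1) • U z)
      =ᶠ[𝓝 y] U := by
    have ho : IsOpen {z : EuclideanSpace ℝ (Fin 3) | a / 2 < ‖z‖ ^ 2} :=
      isOpen_lt continuous_const (continuous_norm.pow 2)
    filter_upwards [ho.mem_nhds hy] with z hz
    rw [Real.smoothTransition.one_of_one_le, one_smul]
    rw [le_sub_iff_add_le, le_div_iff₀ ha]
    have : a / 2 < ‖z‖ ^ 2 := hz
    linarith
  rw [curl_eq_curlCLM, curl_eq_curlCLM, hev.fderiv_eq]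

/-! ### The weighted identity -/

/-- **Weighted zero radial flux.** For `U` smooth off the origin and every smooth profile `η`
vanishing for `s ≤ a` (`a > 0`) and for `s ≥ b`: `∫ η(‖x‖²) ⟨x, curl U(x)⟩/‖x‖ dx = 0` — by parts
against the curl-free radial test field `(η(‖x‖²)/‖x‖) x`, after cutting `U` off near the origin.
[cite: MajdaBertozziCUP2002, §1.1 (vector identities)] -/
theorem integral_weight_mul_radialFlux_eq_zero (hU : ContDiffOn ℝ ∞ U {0}ᶜ) {η : ℝ → ℝ}
    (hη : ContDiff ℝ ∞ η) {a b : ℝ} (ha : 0 < a) (hηa : ∀ s, s ≤ a → η s = 0)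
    (hηb : ∀ s, b ≤ s → η s = 0) :
    ∫ x : EuclideanSpace ℝ (Fin 3), η (‖x‖ ^ 2) * (⟪x, curl U x⟫ / ‖x‖) = 0 := by
  -- the profile `p = η/√·`, the test field `Ψ` and the cut-off field `F`
  set p : ℝ → ℝ := fun s => η s * (Real.sqrt s)⁻¹ with hp
  have hps : ContDiff ℝ 1 p := (contDiff_mul_inv_sqrt hη ha hηa).of_le (by norm_cast)
  have hpb : ∀ s, b ≤ s → p s = 0 := fun s hs => by simp only [hp, hηb s hs, zero_mul]
  set Ψ : EuclideanSpace ℝ (Fin 3) → EuclideanSpace ℝ (Fin 3) := fun y => p (‖y‖ ^ 2) • y with hΨ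
  set F : EuclideanSpace ℝ (Fin 3) → EuclideanSpace ℝ (Fin 3) :=
    fun y => Real.smoothTransition (4 * ‖y‖ ^ 2 / a - 1) • U y with hF
  have key := integral_inner_curl_eq_integral_inner_curl (F := F) (Ψ := Ψ)
    (contDiff_cutoff_smul hU ha) (contDiff_radial hps) (hasCompactSupport_radial hpb)
  have hcurlΨ : ∀ y, curl Ψ y = 0 := fun y => curl_radial_eq_zero hps y
  simp only [hcurlΨ, inner_zero_right, integral_zero] at key
  -- the left integrand is the weighted radial flux
  have hpt : ∀ x : EuclideanSpace ℝ (Fin 3), ⟪curl F x, Ψ x⟫ = η (‖x‖ ^ 2) * (⟪x, curl U x⟫ / ‖x‖) := by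
    intro x
    by_cases hx : ‖x‖ ^ 2 ≤ a
    · simp only [hΨ, hp, hηa _ hx, zero_mul, zero_smul, inner_zero_right]
    · push Not at hx
      have hcurl : curl F x = curl U x := curl_cutoff_smul_eq ha (by linarith)
      rw [hcurl]
      simp only [hΨ, hp, real_inner_smul_right, Real.sqrt_sq (norm_nonneg x), real_inner_comm]
      ring
  rw [← key]
  exact (integral_congr_ae (Eventually.of_forall fun x => (hpt x).symm)).trans rfl

/-! ### Plateaus increasing to the indicator of `(0, 1)` -/

/-- The plateau `η_n(s) = S(ns − 1) S(n(1 − s))` is smooth. [folklore] -/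
theorem contDiff_plateau (n : ℕ) : ContDiff ℝ ∞ (fun s : ℝ =>
    Real.smoothTransition (n * s - 1) * Real.smoothTransition (n * (1 - s))) :=
  (Real.smoothTransition.contDiff.comp (by fun_prop)).mul
    (Real.smoothTransition.contDiff.comp (by fun_prop))

/-- The plateau vanishes for `s ≤ 1/n`. [folklore] -/
theorem plateau_eq_zero_of_le {n : ℕ} (hn : 0 < n) {s : ℝ} (hs : s ≤ 1 / n) :
    Real.smoothTransition (n * s - 1) * Real.smoothTransition (n * (1 - s)) = 0 := by
  have hn' : (0 : ℝ) < n := by exact_mod_cast hn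
  rw [Real.smoothTransition.zero_of_nonpos, zero_mul]
  rw [le_div_iff₀ hn'] at hs
  linarith

/-- The plateau vanishes for `s ≥ 1`. [folklore] -/
theorem plateau_eq_zero_of_one_le (n : ℕ) {s : ℝ} (hs : 1 ≤ s) :
    Real.smoothTransition (n * s - 1) * Real.smoothTransition (n * (1 - s)) = 0 := by
  rw [Real.smoothTransition.zero_of_nonpos (by nlinarith [n.cast_nonneg (α := ℝ)] : (n : ℝ) * (1 - s) ≤ 0),
    mul_zero]

/-- The plateau takes values in `[0, 1]`. [folklore] -/
theorem abs_plateau_le_one (n : ℕ) (s : ℝ) :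
    |Real.smoothTransition (n * s - 1) * Real.smoothTransition (n * (1 - s))| ≤ 1 := by
  rw [abs_mul]
  have h1 := Real.smoothTransition.nonneg (n * s - 1)
  have h2 := Real.smoothTransition.le_one (n * s - 1)
  have h3 := Real.smoothTransition.nonneg (n * (1 - s))
  have h4 := Real.smoothTransition.le_one (n * (1 - s))
  rw [abs_of_nonneg h1, abs_of_nonneg h3]
  nlinarith

/-- On `(0, 1)` the plateaus are eventually equal to `1`. [folklore] -/
theorem eventually_plateau_eq_one {s : ℝ} (hs0 : 0 < s) (hs1 : s < 1) :
    ∀ᶠ n : ℕ in atTop, Real.smoothTransition (n * s - 1) * Real.smoothTransition (n * (1 - s)) = 1 := by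
  obtain ⟨N, hN⟩ := exists_nat_ge (max (2 / s) (1 / (1 - s)))
  filter_upwards [eventually_ge_atTop N] with n hn
  have hn' : (N : ℝ) ≤ n := by exact_mod_cast hn
  have h2 : 2 / s ≤ n := ((le_max_left _ _).trans hN).trans hn'
  have h3 : 1 / (1 - s) ≤ n := ((le_max_right _ _).trans hN).trans hn'
  rw [div_le_iff₀ hs0] at h2
  rw [div_le_iff₀ (by linarith)] at h3
  rw [Real.smoothTransition.one_of_one_le (by linarith),
    Real.smoothTransition.one_of_one_le (by linarith), mul_one]

/-! ### Part (i): the zero radial mean -/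

/-- The radial flux density `⟨x, curl U(x)⟩/‖x‖` is measurable. [folklore] -/
theorem measurable_radialFlux (U : EuclideanSpace ℝ (Fin 3) → EuclideanSpace ℝ (Fin 3)) :
    Measurable fun x : EuclideanSpace ℝ (Fin 3) => ⟪x, curl U x⟫ / ‖x‖ := by
  have hc : Measurable (curl U) := by
    rw [curl_eq_curlCLM_comp]
    exact curlCLM.continuous.measurable.comp (measurable_fderiv ℝ U)
  exact (measurable_id.inner hc).div measurable_norm

/-- **The radial flux density is integrable on the unit ball** (`|⟨x, ω⟩/‖x‖| ≤ ‖ω(x)‖ ≤ M‖x‖⁻²`,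
and `‖x‖⁻²` is integrable on balls of `ℝ³`). [cite: MajdaBertozziCUP2002, §2.3] -/
theorem integrableOn_radialFlux (hU : ContDiffOn ℝ ∞ U {0}ᶜ)
    (hhom : ∀ x : EuclideanSpace ℝ (Fin 3), x ≠ 0 → ∀ c : ℝ, 0 < c → U (c • x) = c⁻¹ • U x) :
    IntegrableOn (fun x : EuclideanSpace ℝ (Fin 3) => ⟪x, curl U x⟫ / ‖x‖) (ball 0 1) := by
  obtain ⟨M, hM0, hM⟩ := exists_norm_curl_le hU hhom
  refine integrableOn_ball_of_norm_le_rpow (by rw [finrank_euclideanSpace_fin]; norm_num) (C := M)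
    (α := 2) (by rw [finrank_euclideanSpace_fin]; norm_num) (Eventually.of_forall fun x => ?_)
    (measurable_radialFlux U).aestronglyMeasurable
  by_cases hx : x = 0
  · subst hx; simp [Real.zero_rpow (by norm_num : (-(2:ℝ)) ≠ 0)]
  · have hn : 0 < ‖x‖ := norm_pos_iff.2 hx
    calc ‖⟪x, curl U x⟫ / ‖x‖‖ = |⟪x, curl U x⟫| / ‖x‖ := by
          rw [Real.norm_eq_abs, abs_div, abs_norm]
      _ ≤ ‖x‖ * ‖curl U x‖ / ‖x‖ := by gcongr; exact abs_real_inner_le_norm _ _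
      _ = ‖curl U x‖ := by field_simp
      _ ≤ M * ‖x‖ ^ (-(2:ℝ)) := hM x hx

/-- **Part (i) of `ConeStructure`: the radial part of the vorticity of a `(−1)`-homogeneous field
smooth off the origin has zero mean on the unit ball**, `∫_{B₁} ⟨x, curl U(x)⟩/‖x‖ dx = 0`
(weighted identity for the plateaus `η_n(‖x‖²)`, dominated convergence).
[cite: MajdaBertozziCUP2002, §1.1 (vector identities)] -/
theorem integral_radialFlux_ball_eq_zero (hU : ContDiffOn ℝ ∞ U {0}ᶜ)
    (hhom : ∀ x : EuclideanSpace ℝ (Fin 3), x ≠ 0 → ∀ c : ℝ, 0 < c → U (c • x) = c⁻¹ • U x) :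
    ∫ x in ball (0 : EuclideanSpace ℝ (Fin 3)) 1, ⟪x, curl U x⟫ / ‖x‖ = 0 := by
  set f : EuclideanSpace ℝ (Fin 3) → ℝ := fun x => ⟪x, curl U x⟫ / ‖x‖ with hf
  -- the plateaus, shifted so that `n + 1 ≥ 1`
  set η : ℕ → ℝ → ℝ := fun n s =>
    Real.smoothTransition ((n + 1 : ℕ) * s - 1) * Real.smoothTransition ((n + 1 : ℕ) * (1 - s)) with hη
  set G : ℕ → EuclideanSpace ℝ (Fin 3) → ℝ := fun n x => η n (‖x‖ ^ 2) * f x with hG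
  have hfi : IntegrableOn f (ball 0 1) := integrableOn_radialFlux hU hhom
  have hfi' : IntegrableOn (fun x => ‖f x‖) (ball (0 : EuclideanSpace ℝ (Fin 3)) 1) := hfi.norm
  -- each weighted integral vanishes
  have hG0 : ∀ n, ∫ x, G n x = 0 := fun n =>
    integral_weight_mul_radialFlux_eq_zero hU (contDiff_plateau (n + 1)) (a := 1 / (n + 1 : ℕ))
      (b := 1) (by positivity) (fun s hs => plateau_eq_zero_of_le (Nat.succ_pos n) hs)
      (fun s hs => plateau_eq_zero_of_one_le (n + 1) hs)
  -- dominated convergence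
  have hlim : Tendsto (fun n => ∫ x, G n x) atTop (𝓝 (∫ x, (ball (0 : EuclideanSpace ℝ (Fin 3)) 1).indicator f x)) := by
    refine tendsto_integral_of_dominated_convergence (fun x => (ball (0 : EuclideanSpace ℝ (Fin 3)) 1).indicator (fun x => ‖f x‖) x)
      (fun n => ?_) (hfi'.integrable_indicator measurableSet_ball) (fun n => Eventually.of_forall fun x => ?_)
      (Eventually.of_forall fun x => ?_)
    · -- measurability
      exact (((contDiff_plateau (n + 1)).continuous.comp (continuous_norm.pow 2)).measurable.mul
        (measurable_radialFlux U)).aestronglyMeasurable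
    · -- domination
      by_cases hx : x ∈ ball (0 : EuclideanSpace ℝ (Fin 3)) 1
      · rw [indicator_of_mem hx, hG, norm_mul]
        exact mul_le_of_le_one_left (norm_nonneg _) (by rw [Real.norm_eq_abs]; exact abs_plateau_le_one _ _)
      · rw [indicator_of_notMem hx]
        have h1 : 1 ≤ ‖x‖ ^ 2 := by
          rw [mem_ball, dist_zero_right, not_lt] at hx
          nlinarith
        simp only [hG, hη, plateau_eq_zero_of_one_le _ h1, zero_mul, norm_zero, le_refl]
    · -- pointwise convergence
      by_cases hx : x ∈ ball (0 : EuclideanSpace ℝ (Fin 3)) 1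
      · rw [indicator_of_mem hx]
        by_cases h0 : x = 0
        · subst h0
          have : ∀ n, G n 0 = 0 := fun n => by simp [hG, hf]
          simp only [this, hf, inner_zero_left, zero_div]
          exact tendsto_const_nhds
        · have hs0 : 0 < ‖x‖ ^ 2 := by positivity
          have hs1 : ‖x‖ ^ 2 < 1 := by
            rw [mem_ball, dist_zero_right] at hx
            nlinarith [norm_nonneg x]
          have hev := eventually_plateau_eq_one hs0 hs1
          have hev' : ∀ᶠ n : ℕ in atTop, G n x = f x := by
            have h2 : Tendsto (fun n : ℕ => n + 1) atTop atTop := tendsto_add_atTop_nat 1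
            filter_upwards [h2.eventually hev] with n hn
            simp only [hG, hη]
            rw [hn, one_mul]
          exact tendsto_const_nhds.congr' (hev'.mono fun n hn => hn.symm)
      · rw [indicator_of_notMem hx]
        have h1 : 1 ≤ ‖x‖ ^ 2 := by
          rw [mem_ball, dist_zero_right, not_lt] at hx
          nlinarith
        have : ∀ n, G n x = 0 := fun n => by
          simp only [hG, hη, plateau_eq_zero_of_one_le _ h1, zero_mul]
        simp only [this]
        exact tendsto_const_nhds
  simp only [hG0] at hlim
  have h := tendsto_nhds_unique hlim tendsto_const_nhds
  rw [integral_indicator measurableSet_ball] at h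
  exact h

end Summit.NavierStokesRegularity.NavierStokesRegularity.Theorems.ConeStructure
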